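import Literature.Geometry.Riemannian.MetricFlowSliceCompactness
import Literature.Geometry.Riemannian.GromovW1CommonSpace
import Literature.Geometry.Riemannian.MetricFlowCorrespondence
import Literature.Geometry.Riemannian.MetricFlowAverageDistanceMonotone
import Literature.Geometry.Riemannian.MetricFlowWassersteinMonotoneGeneral
import HarnessLib

/-!
# Subconvergence within a correspondence over finitely many times — the comparison spaces
# (Bamler 2023, §7.3, Lemma 7.? (arXiv v1 Lemma 161), first part of the proof, (7.20))

R. Bamler, *Compactness theory of the space of super Ricci flows*, Invent. Math. 233 (2023), §7.3,
Lemma (arXiv v1 Lemma 161): *"… after passing to a subsequence, we can find a correspondence `ℭ₀`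
between the metric flows `𝒳ⁱ` over `I₀` that is also fully defined over `I₀` such that the metric
flow pairs … form Cauchy sequence within `ℭ₀` uniformly over `I₀`"*. First part of the printed
proof: *"Write `I₀ =: {t₁ < … < t_N}`. By Proposition 4.1 and Theorem 2.23 we may pass to a
subsequence such that for all `k = 1, …, N`, `(𝒳ⁱ_{t_k}, dⁱ_{t_k}, μⁱ_{t_k}) → (X^∞_{t_k}, d^∞_{t_k},
μ^∞_{t_k})` in `GW₁` … By [Greven–Pfaffelhuber–Winter] … we can find complete and separable
metric spaces `(Z_{t_k}, d^Z_{t_k})` and isometric embeddings `φ^i_{t_k} : 𝒳ⁱ_{t_k} → Z_{t_k}`,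
`φ^∞_{t_k} : X^∞_{t_k} → Z_{t_k}` with `(φ^i_{t_k})_* μⁱ_{t_k} → (φ^∞_{t_k})_* μ^∞_{t_k}` in `W₁`
(7.20)."*

This file carries this out for `H`-concentrated metric flow pairs `P n` over `[a, T]`, defined on
`(a, T)`, with `Var(μⁿ_t) ≤ V`, and a finite `I₀ ⊆ (a, T)`:

* `MetricFlow.gradient_property_zero`,
  `MetricFlow.IsConjugateHeatFlow.lintegral_eq_lintegral_lintegral_condKernel`,
  `MetricFlow.IsHConcentrated.wassersteinW1_map_condKernel_le_edist` — the three inputs of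
  Claim 7.? (arXiv v1 Claim 162) read off a metric flow pair (the gradient property at `T = 0`,
  `μ_s = ∫ ν_{x;s} dμ_t(x)`, and the `1`-Lipschitz dependence of the pushed kernels on the base point);
* `MetricFlowPair.exists_subseq_forall_common_space` — **STEP 1–2 of the proof**: one subsequence
  along which, for every `t ∈ I₀`, the slices `𝒳ⁿ_t` embed isometrically into a common Polish space
  `Z_t` with `W₁`-convergent push-forwards `(φⁿ_t)_* μⁿ_t → m_t`, `Var(m_t) < ∞` (the slices lie in
  `𝕄_1(max V 1, b)` by `IsHConcentrated.isMVb_slice`, Theorem 2.23 =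
  `exists_tendsto_subseq_of_isMVb_slices`, then `exists_common_polish_of_tendsto_gromovW1`;
  finitely many successive extractions by induction on `I₀`);
* `MetricFlowPair.exists_subseq_familyCorrespondence_tendsto` — the same packaged as a
  correspondence `ℭ` over `I₀`, fully defined over `I₀`, with Polish comparison spaces.

Everything is proved; no definitions, no named facts.

## References

* R. H. Bamler, *Compactness theory of the space of super Ricci flows*, Invent. Math. 233 (2023),
  1121–1277 (arXiv:2008.09298), §7.3, Lemma 7.? (arXiv v1 Lemma 161), proof, (7.20); §4.1,
  Prop. 4.1; §2.5, Thm. 2.23. [Bamler2023]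
-/

noncomputable section

open Set MeasureTheory Filter TopologicalSpace Function
open scoped Topology ENNReal NNReal

namespace Literature.Geometry.Riemannian

universe u

namespace MetricFlow

variable {I : Set ℝ} (𝒳 : MetricFlow.{u} I)

/-! ### Inputs of Claim 7.? (arXiv v1 Claim 162) -/

/-- **The gradient property at `T = 0`** (item (6) of Def. 3.2 with `T = 0`: no assumption on the
initial datum `u`): for `s < t` and a measurable `u : 𝒳_s → [0, 1]`, `x ↦ ∫ u dν_{x;s}` is constant
or `Φ ∘ f` with `f` `(t − s)^{-1/2}`-Lipschitz. [cite: Bamler2023, §3.1, Def. 3.2 (metric flow), (6)] -/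
theorem gradient_property_zero {s t : I} (hst : (s : ℝ) < t) (u : 𝒳.Slice s → ℝ)
    (hu : Measurable u) (h01 : ∀ y, u y ∈ Icc (0 : ℝ) 1) :
    (∃ c : ℝ, ∀ x : 𝒳.Slice t, ∫ y, u y ∂(𝒳.condKernel x s) = c) ∨
      ∃ f : 𝒳.Slice t → ℝ, LipschitzWith (Real.toNNReal (1 / Real.sqrt ((t : ℝ) - s))) f ∧
        ∀ x : 𝒳.Slice t, ∫ y, u y ∂(𝒳.condKernel x s) = Phi (f x) := by
  have h := 𝒳.gradient_property hst 0 le_rfl u hu h01 (fun h0 ↦ (lt_irrefl _ h0).elim)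
  rwa [add_zero] at h

variable {𝒳}

/-- **`∫ f dμ_s = ∫ (∫ f dν_{x;s}) dμ_t(x)`** for a conjugate heat flow, `s ≤ t` in `I'`, and a
measurable `f ≥ 0` (`μ_s = ∫ ν_{x;s} dμ_t(x)`, `IsConjugateHeatFlow.eq_bind`).
[cite: Bamler2023, §3.2, Definition (conjugate heat flow)] -/
theorem IsConjugateHeatFlow.lintegral_eq_lintegral_lintegral_condKernel {I' : Set ℝ}
    {μ : ∀ t : I, Measure (𝒳.Slice t)} (hμ : 𝒳.IsConjugateHeatFlow I' μ) {s t : I}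
    (hs : (s : ℝ) ∈ I') (ht : (t : ℝ) ∈ I') (hst : (s : ℝ) ≤ t) {f : 𝒳.Slice s → ℝ≥0∞}
    (hf : Measurable f) : ∫⁻ y, f y ∂(μ s) = ∫⁻ x, ∫⁻ y, f y ∂(𝒳.condKernel x s) ∂(μ t) := by
  rw [hμ.eq_bind hs ht hst,
    Measure.lintegral_bind (𝒳.kernel hst).measurable.aemeasurable hf.aemeasurable]
  rfl

/-- **The pushed kernels are `1`-Lipschitz in the base point** (Bamler 2023, §7.3, proof of Lemma
7.?: *"the maps `(𝒳ⁱ_{t_k}, dⁱ_{t_k}) → (𝒫(Z_{t_l}), d^{Z_{t_l}}_{W₁})`, `y ↦ (φⁱ_{t_l})_* νⁱ_{y;t_l}`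
are `1`-Lipschitz"*): `d_{W₁}((φ)_* ν_{x;s}, (φ)_* ν_{x';s}) ≤ d_t(x, x')` for an isometric embedding
`φ` of `𝒳_s`, in an `H`-concentrated flow (Prop. 3.24 (c), `wassersteinW1_condKernel_le_edist`).
[cite: Bamler2023, §3.2, Prop. 3.24 (c); §7.3, Lemma 7.? (arXiv v1 Lemma 161), proof] -/
theorem IsHConcentrated.wassersteinW1_map_condKernel_le_edist {H : ℝ} (hH : 𝒳.IsHConcentrated H)
    {s t : I} (hst : (s : ℝ) ≤ t) {Z : Type*} [MetricSpace Z] [MeasurableSpace Z] [BorelSpace Z]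
    {φ : 𝒳.Slice s → Z} (hφ : Isometry φ) (x x' : 𝒳.Slice t) :
    wassersteinW1 ((𝒳.condKernel x s).map φ) ((𝒳.condKernel x' s).map φ) ≤ edist x x' :=
  (wassersteinW1_map_le_of_edist_le hφ.continuous.measurable (fun a b ↦ (hφ.edist_eq a b).le)
    _ _).trans (hH.wassersteinW1_condKernel_le_edist hst x x')

end MetricFlow

/-! ### STEP 1–2: common comparison spaces at finitely many times -/

namespace MetricFlowPair

open MetricFlow

/-- **Bamler 2023, proof of Lemma 7.? (arXiv v1 Lemma 161), first step, (7.20)**: for a sequence of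
`H`-concentrated metric flow pairs over `[a, T]`, defined over `(a, T)`, with `Var(μⁿ_t) ≤ V`, and a
finite `I₀ ⊆ (a, T)`, there is ONE subsequence `φ` along which, for every `t ∈ I₀`, the slices
`𝒳^{φ n}_t` embed isometrically (`e n`) into a common complete separable metric space `Z_t` and
`(e n)_* μ^{φ n}_t → m_t` in `d_{W₁}` for a probability measure `m_t` of finite variance. Proof: by
induction on `I₀`; at a new time `t₀`, the slices lie in `𝕄_1(max V 1, b_{H, max V 1, (T−t₀)/2})`
(`IsHConcentrated.isMVb_slice`, the variance bounds at the future times `t₀ + τ ∈ (a, T)`), hence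
subconverge in `d_{GW₁}` (Thm. 2.23, `exists_tendsto_subseq_of_isMVb_slices`) to a space of variance
`≤ max V 1`, and `exists_common_polish_of_tendsto_gromovW1` gives `Z_{t₀}`; the data at the earlier
times pass to the further subsequence. [cite: Bamler2023, §7.3, Lemma 7.? (arXiv v1 Lemma 161), proof, (7.20)] -/
theorem exists_subseq_forall_common_space {a T H V : ℝ}
    (P : ℕ → MetricFlowPair.{u} (Icc a T)) (hP : ∀ n, (P n).flow.IsHConcentrated H)
    (hI : ∀ n, Ioo a T ⊆ (P n).I')
    (hvar : ∀ n (t : (P n).I'), variance ((P n).μ t) ((P n).μ t) ≤ ENNReal.ofReal V)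
    (I₀ : Finset ℝ) (hI₀ : (↑I₀ : Set ℝ) ⊆ Ioo a T) :
    ∃ φ : ℕ → ℕ, StrictMono φ ∧ ∀ t (ht : t ∈ I₀),
      ∃ (Z : Type u) (_ : MetricSpace Z) (_ : MeasurableSpace Z) (_ : BorelSpace Z)
        (_ : SecondCountableTopology Z) (_ : CompleteSpace Z)
        (e : ∀ n, (P (φ n)).flow.Slice ⟨t, hI (φ n) (hI₀ ht)⟩ → Z) (m : Measure Z),
        IsProbabilityMeasure m ∧ (∀ n, Isometry (e n)) ∧ variance m m ≠ ∞ ∧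
          Tendsto (fun n ↦ wassersteinW1 (((P (φ n)).μ ⟨t, hI (φ n) (hI₀ ht)⟩).map (e n)) m)
            atTop (𝓝 0) := by
  classical
  haveI : ∀ n (t : (P n).I'), SecondCountableTopology ((P n).flow.Slice t) := fun n t ↦
    UniformSpace.secondCountable_of_separable _
  revert hI₀
  refine Finset.induction_on I₀ (fun _ ↦ ⟨id, strictMono_id, fun t ht ↦ absurd ht (by simp)⟩) ?_
  intro t₀ s _ ih hI₀
  have hs : (↑s : Set ℝ) ⊆ Ioo a T := fun t ht ↦ hI₀ (Finset.mem_insert_of_mem ht)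
  have ht₀ : t₀ ∈ Ioo a T := hI₀ (Finset.mem_insert_self t₀ s)
  obtain ⟨φ', hφ', hdata⟩ := ih hs
  -- the slices at `t₀` along `φ'` lie in `𝕄_1(V', b_{H, V', θ})`
  set V' : ℝ := max V 1 with hV'_def
  have hV' : 0 < V' := lt_max_of_lt_right one_pos
  set θ : ℝ := (T - t₀) / 2 with hθ_def
  have hθ : 0 < θ := by rw [hθ_def]; linarith [ht₀.2]
  have hmem : ∀ n, t₀ ∈ (P n).I' := fun n ↦ hI n ht₀
  have hVle : ∀ n (t : (P n).I'),
      variance ((P n).μ t) ((P n).μ t) ≤ ENNReal.ofReal (V' * 1 ^ 2) := fun n t ↦ by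
    rw [one_pow, mul_one]
    exact (hvar n t).trans (ENNReal.ofReal_le_ofReal (le_max_left _ _))
  have hMVb : ∀ i, IsMVb ((P (φ' i)).μ ⟨t₀, hmem (φ' i)⟩) 1 V' (sliceMassBound H V' θ) := by
    intro i
    refine (hP (φ' i)).isMVb_slice (P (φ' i)).isConjugateHeatFlow (hmem (φ' i)) one_pos hV' hθ
      (hVle _ _) fun τ hτ ↦ ?_
    have hτ' : t₀ + τ * 1 ^ 2 ∈ Ioo a T := by
      rw [one_pow, mul_one]
      refine ⟨by linarith [ht₀.1, hτ.1], ?_⟩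
      have h2 := hτ.2
      rw [hθ_def] at h2
      linarith [ht₀.2]
    exact ⟨⟨t₀ + τ * 1 ^ 2, hI _ hτ'⟩, rfl, hI _ hτ', hVle _ _⟩
  haveI : ∀ i, IsProbabilityMeasure ((P (φ' i)).μ ⟨t₀, hmem (φ' i)⟩) := fun i ↦
    isProbabilityMeasure_μ _ _
  -- Theorem 2.23: subconvergence in `d_{GW₁}`
  obtain ⟨ψ, hψ, S, _, _, _, _, _, ρ, hρ, hρMVb, hlim⟩ :=
    exists_tendsto_subseq_of_isMVb_slices (fun i ↦ (P (φ' i)).flow) (fun i ↦ ⟨t₀, hmem (φ' i)⟩)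
      (fun i ↦ (P (φ' i)).μ ⟨t₀, hmem (φ' i)⟩) one_pos hV'.le hMVb
  haveI := hρ
  -- Greven–Pfaffelhuber–Winter: a common Polish space with `W₁`-convergent push-forwards
  obtain ⟨Z, _, _, _, _, _, e, e', he, he', hW⟩ :=
    exists_common_polish_of_tendsto_gromovW1
      (X := fun k ↦ (P (φ' (ψ k))).flow.Slice ⟨t₀, hmem (φ' (ψ k))⟩)
      (fun k ↦ (P (φ' (ψ k))).μ ⟨t₀, hmem (φ' (ψ k))⟩) ρ hlim
  refine ⟨φ' ∘ ψ, hφ'.comp hψ, fun t ht ↦ ?_⟩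
  rcases Finset.mem_insert.1 ht with rfl | hts
  · refine ⟨Z, inferInstance, inferInstance, inferInstance, inferInstance, inferInstance, e,
      ρ.map e', Measure.isProbabilityMeasure_map he'.continuous.measurable.aemeasurable, he, ?_, hW⟩
    rw [variance_map_isometry he' ρ]
    exact ne_top_of_le_ne_top ENNReal.ofReal_ne_top hρMVb.1
  · obtain ⟨Z', i1, i2, i3, i4, i5, e', m', hm'P, he', hm'V, hconv'⟩ := hdata t hts
    exact ⟨Z', i1, i2, i3, i4, i5, fun n ↦ e' (ψ n), m', hm'P, fun n ↦ he' (ψ n), hm'V,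
      hconv'.comp hψ.tendsto_atTop⟩

/-- **STEP 1–2 of the proof of Lemma 7.? (arXiv v1 Lemma 161), packaged as a correspondence**:
after passing to a subsequence `φ`, there are a correspondence `ℭ` between the flows `𝒳^{φ n}` over
`I₀`, fully defined over `I₀`, with complete separable comparison spaces `Z_t`, and probability
measures `m_t` on `Z_t` of finite variance with `(φⁿ_t)_* μ^{φ n}_t → m_t` in `d_{W₁}` for all
`t ∈ I₀` ((7.20)). [cite: Bamler2023, §7.3, Lemma 7.? (arXiv v1 Lemma 161), proof, (7.20)] -/
theorem exists_subseq_familyCorrespondence_tendsto {a T H V : ℝ}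
    (P : ℕ → MetricFlowPair.{u} (Icc a T)) (hP : ∀ n, (P n).flow.IsHConcentrated H)
    (hI : ∀ n, Ioo a T ⊆ (P n).I')
    (hvar : ∀ n (t : (P n).I'), variance ((P n).μ t) ((P n).μ t) ≤ ENNReal.ofReal V)
    (I₀ : Finset ℝ) (hI₀ : (↑I₀ : Set ℝ) ⊆ Ioo a T) :
    ∃ φ : ℕ → ℕ, StrictMono φ ∧
      ∃ (ℭ : FamilyCorrespondence (fun n ↦ (P (φ n)).flow) (↑I₀ : Set ℝ))
        (hfull : ℭ.FullyDefinedOver ↑I₀),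
        (∀ t, SecondCountableTopology (ℭ.Z t)) ∧ (∀ t, CompleteSpace (ℭ.Z t)) ∧
        ∃ m : ∀ t : ↥(↑I₀ : Set ℝ), Measure (ℭ.Z t), (∀ t, IsProbabilityMeasure (m t)) ∧
          (∀ t, variance (m t) (m t) ≠ ∞) ∧
          ∀ t (ht : t ∈ (↑I₀ : Set ℝ)), Tendsto (fun n ↦ wassersteinW1
            (((P (φ n)).μ ⟨t, (ℭ.dom_subset n (hfull n ht)).1⟩).map (ℭ.φ n t (hfull n ht)))
            (m ⟨t, ht⟩)) atTop (𝓝 0) := by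
  obtain ⟨φ, hφ, h⟩ := exists_subseq_forall_common_space P hP hI hvar I₀ hI₀
  choose Z i1 i2 i3 i4 i5 e m hmP he hmV hconv using h
  refine ⟨φ, hφ,
    { Z := fun t ↦ Z t.1 t.2
      instMetricSpace := fun t ↦ i1 t.1 t.2
      instMeasurableSpace := fun t ↦ i2 t.1 t.2
      instBorelSpace := fun t ↦ i3 t.1 t.2
      dom := fun _ ↦ ↑I₀
      dom_subset := fun n t ht ↦ ⟨hI (φ n) (hI₀ ht), ht⟩
      φ := fun n t ht ↦ e t ht n
      isometry := fun n t ht ↦ he t ht n }, fun _ ↦ Subset.rfl, fun t ↦ i4 t.1 t.2,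
    fun t ↦ i5 t.1 t.2, fun t ↦ m t.1 t.2, fun t ↦ hmP t.1 t.2, fun t ↦ hmV t.1 t.2,
    fun t ht ↦ hconv t ht⟩

end MetricFlowPair

end Literature.Geometry.Riemannian

end
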